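import Summits.CriticalPhenomena.Ising3DConformalLimit.Theorems.LinkingParityCirclesSpinRatioMoebiusTwoPointPrelim
import HarnessLib

/-!
# Crux `LinkingParityCircles.SpinRatioMoebius` (stmt-CriticalPhenomena-4530), line `registered` —
# helper file 2/3 for stub `stub_twoPointOfRatioLimit`: the auxiliary configurations

For a direction `i` and mesh `δ`, the pinned lattice point `δ•⌊1/δ⌋eᵢ` is within `δ` of `eᵢ`; the two auxiliary
4-point configurations `A = (0, δk, u, u + δk)` and `B = (0, u, δk, u + δk)` (`k = ⌊1/δ⌋eᵢ`) are non-coincident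
exactly when `u ∉ {0, ±eᵢ}`, approximate their `δ = 0` versions uniformly in `u`, and satisfy the exact identity
`K_δ(u)² · Q^δ_2(A) = Q^δ_2(B)` with `K_δ(u) = ⟨σ₀σ_{[u/δ]}⟩/⟨σ₀σ_{⌊1/δ⌋e₀}⟩` (`ksq_mul_configA_eq_configB`).  Hence,
if the 4-point pairing ratio `Q^δ_2` converges locally uniformly to a continuous `q4`, then along `A` and `B` it
converges to `q4(0, eᵢ, u, u + eᵢ)`, `q4(0, u, eᵢ, u + eᵢ)` locally uniformly on the good set `Uᵢ`
(`tendsto_configA/B`, by the perturbed-composition lemma of file 1/3), and `K_δ² → q4(B)/q4(A)` uniformly on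
compact subsets of `Uᵢ` (`tendstoUniformlyOn_ksq`).

References: S. Friedli, Y. Velenik (CUP 2017) Thm. 3.17 (translation invariance), Exercise 3.14 (lattice symmetries),
Thm. 3.20 (GKS).
-/

noncomputable section

namespace Summit.CriticalPhenomena.Ising3DConformalLimit.Cruxes.SpinRatioMoebius.Birth

open Literature.Probability.LatticeModels Filter Set Metric
open Summit.CriticalPhenomena.Ising3DConformalLimit.MoebiusLimitExistsNegative
open Summit.CriticalPhenomena.Ising3DConformalLimit.Cruxes.IsingEuclidUpgradeR4NonGaussian.FreeCovarianceDeltaDichotomy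
  (criticalCorr_two_pos')
open Summit.CriticalPhenomena.Ising3DConformalLimit.Theorems.MoebiusLimitOfTwoPointLaw.Negative
  (latticeApprox_smul tendsto_div_const_nhdsGT)
open scoped Topology

/-! ## §D Geometry of the auxiliary configurations -/

/-- `![0, e, u, u + e]` is non-coincident when `e ≠ 0`, `u ∉ {0, e, −e}`. [folklore] -/
theorem configA_mem_nonCoincident {e u : EuclideanSpace ℝ (Fin 3)} (he : e ≠ 0) (hu : u ≠ 0) (hue : u ≠ e)
    (hune : u ≠ -e) : (![0, e, u, u + e] : Fin (2 + 2) → EuclideanSpace ℝ (Fin 3)) ∈ NonCoincident 3 (2 + 2) := by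
  have hue1 : u + e ≠ 0 := fun h => hune (eq_neg_of_add_eq_zero_left h)
  have hue2 : u + e ≠ e := fun h => hu (by simpa using h)
  have hue3 : u + e ≠ u := fun h => he (by simpa using h)
  rw [mem_nonCoincident]
  intro a b hab
  fin_cases a <;> fin_cases b <;> simp_all [eq_comm]

/-- `![0, u, e, u + e]` is non-coincident when `e ≠ 0`, `u ∉ {0, e, −e}`. [folklore] -/
theorem configB_mem_nonCoincident {e u : EuclideanSpace ℝ (Fin 3)} (he : e ≠ 0) (hu : u ≠ 0) (hue : u ≠ e)
    (hune : u ≠ -e) : (![0, u, e, u + e] : Fin (2 + 2) → EuclideanSpace ℝ (Fin 3)) ∈ NonCoincident 3 (2 + 2) := by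
  have hue1 : u + e ≠ 0 := fun h => hune (eq_neg_of_add_eq_zero_left h)
  have hue2 : u + e ≠ e := fun h => hu (by simpa using h)
  have hue3 : u + e ≠ u := fun h => he (by simpa using h)
  rw [mem_nonCoincident]
  intro a b hab
  fin_cases a <;> fin_cases b <;> simp_all [eq_comm]

/-- Conversely, non-coincidence of `![0, e, u, u + e]` forces `u ∉ {0, e, −e}`. [folklore] -/
theorem of_configA_mem_nonCoincident {e u : EuclideanSpace ℝ (Fin 3)}
    (h : (![0, e, u, u + e] : Fin (2 + 2) → EuclideanSpace ℝ (Fin 3)) ∈ NonCoincident 3 (2 + 2)) :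
    u ≠ 0 ∧ u ≠ e ∧ u ≠ -e := by
  rw [mem_nonCoincident] at h
  refine ⟨fun hu => ?_, fun hue => ?_, fun hune => ?_⟩
  · have := @h 0 2 (by simp [hu])
    exact absurd this (by decide)
  · have := @h 1 2 (by simp [hue])
    exact absurd this (by decide)
  · have := @h 0 3 (by simp [hune])
    exact absurd this (by decide)

/-- The unit vector `eᵢ = siteVec (Pi.single i 1)` is nonzero. [folklore] -/
theorem siteVec_single_ne_zero (i : Fin 3) : siteVec (Pi.single i (1:ℤ) : Site 3) ≠ 0 := by
  intro h
  have := congr_arg (fun v : EuclideanSpace ℝ (Fin 3) => v i) h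
  simp [siteVec_apply] at this

/-- The pinned point `δ • ⌊1/δ⌋ eᵢ` is within `δ` of `eᵢ` (`0 < δ`). [folklore] -/
theorem dist_pin_le :
    ∀ {δ : ℝ}, 0 < δ → ∀ (i : Fin 3), dist (δ • Literature.Probability.LatticeModels.siteVec (Pi.single i ⌊1 / δ⌋ : Literature.Probability.LatticeModels.Site 3)) (Literature.Probability.LatticeModels.siteVec (Pi.single i (1:ℤ) : Literature.Probability.LatticeModels.Site 3)) ≤ δ := by
  intro δ hδ i
  rw [dist_eq_norm, EuclideanSpace.norm_eq]
  have hcoord : ∀ j : Fin 3, ‖(δ • siteVec (Pi.single i ⌊1 / δ⌋ : Site 3) - siteVec (Pi.single i (1:ℤ) : Site 3)) j‖ ^ 2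
      ≤ (if j = i then δ ^ 2 else 0) := by
    intro j
    by_cases hj : j = i
    · subst hj
      simp only [PiLp.sub_apply, PiLp.smul_apply, siteVec_apply, Pi.single_eq_same, smul_eq_mul, Int.cast_one,
        if_true, Real.norm_eq_abs, sq_abs]
      have h1 : (⌊1 / δ⌋ : ℝ) ≤ 1 / δ := Int.floor_le _
      have h2 : 1 / δ < (⌊1 / δ⌋ : ℝ) + 1 := Int.lt_floor_add_one _
      have h3 : δ * (1 / δ) = 1 := mul_one_div_cancel hδ.ne'
      have hlo : 1 - δ < δ * (⌊1 / δ⌋ : ℝ) := by nlinarith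
      have hhi : δ * (⌊1 / δ⌋ : ℝ) ≤ 1 := by nlinarith
      nlinarith
    · simp [PiLp.sub_apply, PiLp.smul_apply, siteVec_apply, hj]
  calc Real.sqrt (∑ j, ‖(δ • siteVec (Pi.single i ⌊1 / δ⌋ : Site 3) - siteVec (Pi.single i (1:ℤ) : Site 3)) j‖ ^ 2)
      ≤ Real.sqrt (∑ j : Fin 3, if j = i then δ ^ 2 else 0) :=
        Real.sqrt_le_sqrt (Finset.sum_le_sum fun j _ => hcoord j)
    _ = Real.sqrt (δ ^ 2) := by rw [Finset.sum_ite_eq']; simp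
    _ = δ := Real.sqrt_sq hδ.le

/-- The auxiliary configuration `A` at mesh `δ` approximates its `δ = 0` version uniformly in `u`. [folklore] -/
theorem dist_configA_le {δ : ℝ} (hδ : 0 < δ) (i : Fin 3) (u : EuclideanSpace ℝ (Fin 3)) :
    dist (![0, δ • siteVec (Pi.single i ⌊1 / δ⌋ : Site 3), u, u + δ • siteVec (Pi.single i ⌊1 / δ⌋ : Site 3)] :
        Fin (2 + 2) → EuclideanSpace ℝ (Fin 3))
      ![0, siteVec (Pi.single i (1:ℤ) : Site 3), u, u + siteVec (Pi.single i (1:ℤ) : Site 3)] ≤ δ := by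
  refine (dist_pi_le_iff hδ.le).2 fun b => ?_
  fin_cases b
  · simp [hδ.le]
  · exact dist_pin_le hδ i
  · simp [hδ.le]
  · show dist (u + _) (u + _) ≤ δ
    rw [dist_add_left]; exact dist_pin_le hδ i

/-- The auxiliary configuration `B` at mesh `δ` approximates its `δ = 0` version uniformly in `u`. [folklore] -/
theorem dist_configB_le {δ : ℝ} (hδ : 0 < δ) (i : Fin 3) (u : EuclideanSpace ℝ (Fin 3)) :
    dist (![0, u, δ • siteVec (Pi.single i ⌊1 / δ⌋ : Site 3), u + δ • siteVec (Pi.single i ⌊1 / δ⌋ : Site 3)] :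
        Fin (2 + 2) → EuclideanSpace ℝ (Fin 3))
      ![0, u, siteVec (Pi.single i (1:ℤ) : Site 3), u + siteVec (Pi.single i (1:ℤ) : Site 3)] ≤ δ := by
  refine (dist_pi_le_iff hδ.le).2 fun b => ?_
  fin_cases b
  · simp [hδ.le]
  · simp [hδ.le]
  · exact dist_pin_le hδ i
  · show dist (u + _) (u + _) ≤ δ
    rw [dist_add_left]; exact dist_pin_le hδ i

/-! ## §E The key identity `K² · Q_A = Q_B` -/

/-- `K_δ(u)² · Q^δ_2(0,δk,u,u+δk) = Q^δ_2(0,u,δk,u+δk)` with `K_δ(u) = ⟨σ₀σ_{[u/δ]}⟩/⟨σ₀σ_k⟩`, `k = ⌊1/δ⌋eᵢ`, the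
pin rewritten along `e₀`. [folklore] -/
theorem ksq_mul_configA_eq_configB {δ : ℝ} (hδ : 0 < δ) (i : Fin 3) (u : EuclideanSpace ℝ (Fin 3)) :
    (criticalCorr 3 2 ![0, latticeApprox δ u] / criticalCorr 3 2 ![(0 : Site 3), Pi.single (0 : Fin 3) (⌊1 / δ⌋ : ℤ)]) ^ 2 *
      (criticalCorr 3 (2 + 2) (fun j => latticeApprox δ ((![0, δ • siteVec (Pi.single i ⌊1 / δ⌋ : Site 3), u,
          u + δ • siteVec (Pi.single i ⌊1 / δ⌋ : Site 3)] : Fin (2 + 2) → EuclideanSpace ℝ (Fin 3)) j)) /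
        ∏ j : Fin 2, criticalCorr 3 2 ![latticeApprox δ ((![0, δ • siteVec (Pi.single i ⌊1 / δ⌋ : Site 3), u,
          u + δ • siteVec (Pi.single i ⌊1 / δ⌋ : Site 3)] : Fin (2 + 2) → EuclideanSpace ℝ (Fin 3)) (Fin.castAdd 2 j)),
          latticeApprox δ ((![0, δ • siteVec (Pi.single i ⌊1 / δ⌋ : Site 3), u,
          u + δ • siteVec (Pi.single i ⌊1 / δ⌋ : Site 3)] : Fin (2 + 2) → EuclideanSpace ℝ (Fin 3)) (Fin.natAdd 2 j))]) =
      criticalCorr 3 (2 + 2) (fun j => latticeApprox δ ((![0, u, δ • siteVec (Pi.single i ⌊1 / δ⌋ : Site 3),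
          u + δ • siteVec (Pi.single i ⌊1 / δ⌋ : Site 3)] : Fin (2 + 2) → EuclideanSpace ℝ (Fin 3)) j)) /
        ∏ j : Fin 2, criticalCorr 3 2 ![latticeApprox δ ((![0, u, δ • siteVec (Pi.single i ⌊1 / δ⌋ : Site 3),
          u + δ • siteVec (Pi.single i ⌊1 / δ⌋ : Site 3)] : Fin (2 + 2) → EuclideanSpace ℝ (Fin 3)) (Fin.castAdd 2 j)),
          latticeApprox δ ((![0, u, δ • siteVec (Pi.single i ⌊1 / δ⌋ : Site 3),
          u + δ • siteVec (Pi.single i ⌊1 / δ⌋ : Site 3)] : Fin (2 + 2) → EuclideanSpace ℝ (Fin 3)) (Fin.natAdd 2 j))] := by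
  rw [pairingRatio_two_configA hδ, pairingRatio_two_configB hδ, ← criticalCorr_two_pin i ⌊1 / δ⌋]
  have h1 := criticalCorr_two_pos' (0 : Site 3) (latticeApprox δ u)
  have h2 := criticalCorr_two_pos' (0 : Site 3) (Pi.single i ⌊1 / δ⌋)
  field_simp


/-! ## §F The pinned two-point limit -/

section TwoPoint


/-- The configurations `u ↦ (0, e, u, u + e)` and `u ↦ (0, u, e, u + e)` depend continuously on `u`. [folklore] -/
theorem continuous_configA (e : EuclideanSpace ℝ (Fin 3)) :
    Continuous fun u : EuclideanSpace ℝ (Fin 3) => (![0, e, u, u + e] : Fin (2 + 2) → EuclideanSpace ℝ (Fin 3)) := by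
  refine continuous_pi fun j => ?_
  fin_cases j
  · exact continuous_const
  · exact continuous_const
  · exact continuous_id
  · exact continuous_id.add continuous_const

/-- Continuity of `u ↦ (0, u, e, u + e)`. [folklore] -/
theorem continuous_configB (e : EuclideanSpace ℝ (Fin 3)) :
    Continuous fun u : EuclideanSpace ℝ (Fin 3) => (![0, u, e, u + e] : Fin (2 + 2) → EuclideanSpace ℝ (Fin 3)) := by
  refine continuous_pi fun j => ?_
  fin_cases j
  · exact continuous_const
  · exact continuous_id
  · exact continuous_const
  · exact continuous_id.add continuous_const

/-- The good set `Uᵢ = {u | (0, eᵢ, u, u + eᵢ) non-coincident}` is open. [folklore] -/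
theorem isOpen_goodSet (i : Fin 3) :
    IsOpen {u : EuclideanSpace ℝ (Fin 3) | (![0, (fun (i : Fin 3) => siteVec (Pi.single i (1:ℤ) : Site 3)) i, u, u + (fun (i : Fin 3) => siteVec (Pi.single i (1:ℤ) : Site 3)) i] : Fin (2 + 2) → EuclideanSpace ℝ (Fin 3)) ∈
      NonCoincident 3 (2 + 2)} :=
  (isOpen_nonCoincident 3 (2 + 2)).preimage (continuous_configA _)

variable {q4 : (Fin (2 + 2) → EuclideanSpace ℝ (Fin 3)) → ℝ}

/-- Along configuration `A`: `Q^δ_2(0, δk, u, u + δk) → q4(0, eᵢ, u, u + eᵢ)` locally uniformly on `Uᵢ`. [folklore] -/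
theorem tendsto_configA (h4 : TendstoLocallyUniformlyOn (fun (δ : ℝ) (x : Fin (2 + 2) → EuclideanSpace ℝ (Fin 3)) => criticalCorr 3 (2 + 2) (fun j => latticeApprox δ (x j)) / ∏ j : Fin 2, criticalCorr 3 2 ![latticeApprox δ (x (Fin.castAdd 2 j)), latticeApprox δ (x (Fin.natAdd 2 j))]) q4 (𝓝[>] (0:ℝ)) (NonCoincident 3 (2 + 2)))
    (hcont : ContinuousOn q4 (NonCoincident 3 (2 + 2))) (i : Fin 3) :
    TendstoLocallyUniformlyOn (fun δ u => (fun (δ : ℝ) (x : Fin (2 + 2) → EuclideanSpace ℝ (Fin 3)) => criticalCorr 3 (2 + 2) (fun j => latticeApprox δ (x j)) / ∏ j : Fin 2, criticalCorr 3 2 ![latticeApprox δ (x (Fin.castAdd 2 j)), latticeApprox δ (x (Fin.natAdd 2 j))]) δ ![0, (fun (i : Fin 3) (δ : ℝ) => δ • siteVec (Pi.single i ⌊1 / δ⌋ : Site 3)) i δ, u, u + (fun (i : Fin 3) (δ : ℝ) => δ • siteVec (Pi.single i ⌊1 / δ⌋ : Site 3)) i δ])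
      (fun u => q4 ![0, (fun (i : Fin 3) => siteVec (Pi.single i (1:ℤ) : Site 3)) i, u, u + (fun (i : Fin 3) => siteVec (Pi.single i (1:ℤ) : Site 3)) i]) (𝓝[>] (0:ℝ))
      {u | (![0, (fun (i : Fin 3) => siteVec (Pi.single i (1:ℤ) : Site 3)) i, u, u + (fun (i : Fin 3) => siteVec (Pi.single i (1:ℤ) : Site 3)) i] : Fin (2 + 2) → EuclideanSpace ℝ (Fin 3)) ∈ NonCoincident 3 (2 + 2)} := by
  have h := tendstoLocallyUniformlyOn_comp_of_approx (Y := EuclideanSpace ℝ (Fin 3))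
    (isOpen_nonCoincident 3 (2 + 2)) h4 hcont (isOpen_goodSet i)
    (c := fun u => (![0, (fun (i : Fin 3) => siteVec (Pi.single i (1:ℤ) : Site 3)) i, u, u + (fun (i : Fin 3) => siteVec (Pi.single i (1:ℤ) : Site 3)) i] : Fin (2 + 2) → EuclideanSpace ℝ (Fin 3)))
    (continuous_configA _).continuousOn (fun u hu => hu)
    (c' := fun δ u => (![0, (fun (i : Fin 3) (δ : ℝ) => δ • siteVec (Pi.single i ⌊1 / δ⌋ : Site 3)) i δ, u, u + (fun (i : Fin 3) (δ : ℝ) => δ • siteVec (Pi.single i ⌊1 / δ⌋ : Site 3)) i δ] : Fin (2 + 2) → EuclideanSpace ℝ (Fin 3))) ?_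
  · exact h
  · intro ε hε
    filter_upwards [Ioo_mem_nhdsGT hε] with δ hδ u _
    exact lt_of_le_of_lt (dist_configA_le hδ.1 i u) hδ.2

/-- Along configuration `B`: `Q^δ_2(0, u, δk, u + δk) → q4(0, u, eᵢ, u + eᵢ)` locally uniformly on `Uᵢ`. [folklore] -/
theorem tendsto_configB (h4 : TendstoLocallyUniformlyOn (fun (δ : ℝ) (x : Fin (2 + 2) → EuclideanSpace ℝ (Fin 3)) => criticalCorr 3 (2 + 2) (fun j => latticeApprox δ (x j)) / ∏ j : Fin 2, criticalCorr 3 2 ![latticeApprox δ (x (Fin.castAdd 2 j)), latticeApprox δ (x (Fin.natAdd 2 j))]) q4 (𝓝[>] (0:ℝ)) (NonCoincident 3 (2 + 2)))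
    (hcont : ContinuousOn q4 (NonCoincident 3 (2 + 2))) (i : Fin 3) :
    TendstoLocallyUniformlyOn (fun δ u => (fun (δ : ℝ) (x : Fin (2 + 2) → EuclideanSpace ℝ (Fin 3)) => criticalCorr 3 (2 + 2) (fun j => latticeApprox δ (x j)) / ∏ j : Fin 2, criticalCorr 3 2 ![latticeApprox δ (x (Fin.castAdd 2 j)), latticeApprox δ (x (Fin.natAdd 2 j))]) δ ![0, u, (fun (i : Fin 3) (δ : ℝ) => δ • siteVec (Pi.single i ⌊1 / δ⌋ : Site 3)) i δ, u + (fun (i : Fin 3) (δ : ℝ) => δ • siteVec (Pi.single i ⌊1 / δ⌋ : Site 3)) i δ])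
      (fun u => q4 ![0, u, (fun (i : Fin 3) => siteVec (Pi.single i (1:ℤ) : Site 3)) i, u + (fun (i : Fin 3) => siteVec (Pi.single i (1:ℤ) : Site 3)) i]) (𝓝[>] (0:ℝ))
      {u | (![0, (fun (i : Fin 3) => siteVec (Pi.single i (1:ℤ) : Site 3)) i, u, u + (fun (i : Fin 3) => siteVec (Pi.single i (1:ℤ) : Site 3)) i] : Fin (2 + 2) → EuclideanSpace ℝ (Fin 3)) ∈ NonCoincident 3 (2 + 2)} := by
  have h := tendstoLocallyUniformlyOn_comp_of_approx (Y := EuclideanSpace ℝ (Fin 3))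
    (isOpen_nonCoincident 3 (2 + 2)) h4 hcont (isOpen_goodSet i)
    (c := fun u => (![0, u, (fun (i : Fin 3) => siteVec (Pi.single i (1:ℤ) : Site 3)) i, u + (fun (i : Fin 3) => siteVec (Pi.single i (1:ℤ) : Site 3)) i] : Fin (2 + 2) → EuclideanSpace ℝ (Fin 3)))
    (continuous_configB _).continuousOn ?_
    (c' := fun δ u => (![0, u, (fun (i : Fin 3) (δ : ℝ) => δ • siteVec (Pi.single i ⌊1 / δ⌋ : Site 3)) i δ, u + (fun (i : Fin 3) (δ : ℝ) => δ • siteVec (Pi.single i ⌊1 / δ⌋ : Site 3)) i δ] : Fin (2 + 2) → EuclideanSpace ℝ (Fin 3))) ?_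
  · exact h
  · intro u hu
    obtain ⟨h0, h1, h2⟩ := of_configA_mem_nonCoincident hu
    exact configB_mem_nonCoincident (siteVec_single_ne_zero i) h0 h1 h2
  · intro ε hε
    filter_upwards [Ioo_mem_nhdsGT hε] with δ hδ u _
    exact lt_of_le_of_lt (dist_configB_le hδ.1 i u) hδ.2

/-- `K_δ(u)² → q4(B)/q4(A)` uniformly on compact subsets of `Uᵢ`. [folklore] -/
theorem tendstoUniformlyOn_ksq (h4 : TendstoLocallyUniformlyOn (fun (δ : ℝ) (x : Fin (2 + 2) → EuclideanSpace ℝ (Fin 3)) => criticalCorr 3 (2 + 2) (fun j => latticeApprox δ (x j)) / ∏ j : Fin 2, criticalCorr 3 2 ![latticeApprox δ (x (Fin.castAdd 2 j)), latticeApprox δ (x (Fin.natAdd 2 j))]) q4 (𝓝[>] (0:ℝ)) (NonCoincident 3 (2 + 2)))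
    (hcont : ContinuousOn q4 (NonCoincident 3 (2 + 2))) (i : Fin 3) {C : Set (EuclideanSpace ℝ (Fin 3))}
    (hC : IsCompact C)
    (hCU : C ⊆ {u | (![0, (fun (i : Fin 3) => siteVec (Pi.single i (1:ℤ) : Site 3)) i, u, u + (fun (i : Fin 3) => siteVec (Pi.single i (1:ℤ) : Site 3)) i] : Fin (2 + 2) → EuclideanSpace ℝ (Fin 3)) ∈ NonCoincident 3 (2 + 2)}) :
    TendstoUniformlyOn (fun δ u => ((fun (δ : ℝ) (u : EuclideanSpace ℝ (Fin 3)) => criticalCorr 3 2 ![0, latticeApprox δ u] / criticalCorr 3 2 ![(0 : Site 3), Pi.single (0 : Fin 3) (⌊1 / δ⌋ : ℤ)]) δ u) ^ 2)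
      (fun u => q4 ![0, u, (fun (i : Fin 3) => siteVec (Pi.single i (1:ℤ) : Site 3)) i, u + (fun (i : Fin 3) => siteVec (Pi.single i (1:ℤ) : Site 3)) i] / q4 ![0, (fun (i : Fin 3) => siteVec (Pi.single i (1:ℤ) : Site 3)) i, u, u + (fun (i : Fin 3) => siteVec (Pi.single i (1:ℤ) : Site 3)) i]) (𝓝[>] (0:ℝ)) C := by
  have hA := (tendstoLocallyUniformlyOn_iff_forall_isCompact (isOpen_goodSet i)).1 (tendsto_configA h4 hcont i) C hCU hC
  have hB := (tendstoLocallyUniformlyOn_iff_forall_isCompact (isOpen_goodSet i)).1 (tendsto_configB h4 hcont i) C hCU hC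
  -- bound for `b = q4 ∘ B` on `C`
  have hBmem : ∀ u ∈ C, (![0, u, (fun (i : Fin 3) => siteVec (Pi.single i (1:ℤ) : Site 3)) i, u + (fun (i : Fin 3) => siteVec (Pi.single i (1:ℤ) : Site 3)) i] : Fin (2 + 2) → EuclideanSpace ℝ (Fin 3)) ∈ NonCoincident 3 (2 + 2) := by
    intro u hu
    obtain ⟨h0, h1, h2⟩ := of_configA_mem_nonCoincident (hCU hu)
    exact configB_mem_nonCoincident (siteVec_single_ne_zero i) h0 h1 h2
  have hbcont : ContinuousOn (fun u => q4 ![0, u, (fun (i : Fin 3) => siteVec (Pi.single i (1:ℤ) : Site 3)) i, u + (fun (i : Fin 3) => siteVec (Pi.single i (1:ℤ) : Site 3)) i]) C :=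
    hcont.comp (continuous_configB _).continuousOn fun u hu => hBmem u hu
  obtain ⟨M, hM⟩ := hC.exists_bound_of_continuousOn hbcont
  refine tendstoUniformlyOn_ratio_sq hA hB (fun u hu => one_le_ratioLimit_two h4 (hCU hu)) (le_max_right M 0)
    (fun u hu => (Real.norm_eq_abs _ ▸ hM u hu).trans (le_max_left M 0)) ?_
  filter_upwards [self_mem_nhdsWithin] with δ hδ u _
  exact ksq_mul_configA_eq_configB hδ i u

end TwoPoint


end Summit.CriticalPhenomena.Ising3DConformalLimit.Cruxes.SpinRatioMoebius.Birth

end
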